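import Summits.SmoothPoincare4.SmoothPoincare4.Theorems.CylinderEntropyCylinderRungTwoHamiltonMonotonicityDivergence
import Summits.SmoothPoincare4.SmoothPoincare4.Theorems.CylinderEntropyCylinderRungTwoTiltExcess
import HarnessLib

/-!
# Route `CylinderEntropy`, crux `CylinderRungTwo` (stmt-SmoothPoincare4-7631), line `killing-flux`:
# the vertical test identity `∫_M (Ψ''(z₅) (1 - ν₅²) - H Ψ'(z₅) ν₅) dμ_g = 0`
# (registered helper `helper_verticalTestIdentity`, a first-variation identity consumed by
# `stub_areaQuantization`)

For a closed immersed cross-section `f : M⁴ → N = S⁴ × ℝ = {z ∈ ℝ⁶ | ∑_{i<5} zᵢ² = 1}` with smooth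
unit normal `ν` tangent to `N` and mean curvature `H` (tree `meanCurvature` of `(f, ν)` in `ℝ⁶`), and
for every test function `Ψ ∈ C²(ℝ)` of the HEIGHT `z₅` alone,

  `∫_M (Ψ''(z₅) (1 - ν₅²) - H Ψ'(z₅) ν₅) dμ_g = 0`,   `μ_g` the Riemannian measure of `g = f^*δ`.

This is Green's identity `∫_M Δ_g(φ ∘ f) dμ_g = 0` for the vertical test function `φ(z) = Ψ(z₅)`
(equivalently, the first variation of area along the vertical field `X = Ψ'(z₅) e₅`, whose
tangential divergence is `Ψ''(z₅) |e₅^T|² = Ψ''(z₅) (1 - ν₅²)` because the radial normal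
`n = (z', 0)` of `N` has `n₅ = 0`). We apply the landed ambient form of Green's identity
(`integral_sliceLaplacian_eq_zero`, part 3 of Hamilton's monotonicity,
`…HamiltonMonotonicityDivergence.lean`) to `φ`, for which, with `L = e₅^*` the coordinate functional,
`Dφ_p = Ψ'(p₅) L` and `D²φ_p(a, b) = Ψ''(p₅) a₅ b₅` (chain rule through `L`; for `Ψ ∈ C²`,
`deriv (deriv Ψ)` is the genuine second derivative), so that `Δ_{ℝ⁶} φ = Ψ''(z₅)` (only `j = 5`
survives), `D²φ(n, n) = Dφ(n) = 0` (`n₅ = 0`), `D²φ(ν, ν) = Ψ''(z₅) ν₅²` and `Dφ(ν) = Ψ'(z₅) ν₅`: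
the integrand of `integral_sliceLaplacian_eq_zero` collapses POINTWISE to
`Ψ''(z₅) (1 - ν₅²) - H Ψ'(z₅) ν₅`, and no integrability is needed.

* `hasFDerivAt_verticalTest`, `fderiv_verticalTest`, `fderiv_verticalTest_apply`,
  `hasFDerivAt_fderiv_verticalTest`, `iteratedFDeriv_two_verticalTest`,
  `sum_iteratedFDeriv_two_verticalTest_single`, `contDiff_verticalTest` — the calculus of
  `φ = Ψ ∘ L`;
* `verticalTest_identity` — the identity, with implicit binders;
* `helper_verticalTestIdentity` — the registered helper, verbatim.

The case `Ψ(t) = t² / 2` is the tilt-excess identity `∫_M (1 - ν₅²) dμ_g = ∫_M H z₅ ν₅ dμ_g` of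
`…TiltExcess.lean`; general `Ψ` (e.g. cut-offs of the height) are what the area-quantization
argument tests against.

Everything here is PROVED (no `sorry`, no new definitions, no named facts).

References: R. S. Hamilton, Comm. Anal. Geom. 1 (1993) 127–137, §4 (first variation on slices of
`S⁴ × ℝ`); L. Simon, *Lectures on Geometric Measure Theory* (1983), §16 (first variation,
`∫ div_M X = -∫ ⟨H⃗, X⟩`).
-/

-- the prescribed namespace `Summit.SmoothPoincare4.SmoothPoincare4.…` repeats `SmoothPoincare4`
set_option linter.dupNamespace false

noncomputable section

open Bundle Set Function Filter MeasureTheory Module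
open scoped Manifold ContDiff Topology RealInnerProductSpace BigOperators

namespace Summit.SmoothPoincare4.SmoothPoincare4.Cruxes.CylinderRungTwo.KillingFlux

open Literature.Geometry.Riemannian Literature.Geometry.Riemannian.EuclideanHypersurface
open Literature.Geometry.Lorentzian Literature.Geometry.Lorentzian.PseudoRiemannianMetric
open Literature.Geometry.Riemannian.SphericalCylinderEntropy (truncL truncL_apply)
open Literature.Geometry.Manifold.CylinderSlice (padL padL_apply_castSucc padL_apply_last)

/-! ## Calculus of the vertical test function `φ(z) = Ψ(z₅)` on `ℝ⁶` -/

section VerticalTest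

variable {Ψ : ℝ → ℝ}

/-- The vertical test function `φ(z) = Ψ(z₅)` on `ℝ⁶` has derivative `Dφ_p = Ψ'(p₅) · e₅^*` for
`Ψ` differentiable (chain rule through the coordinate functional `e₅^* = EuclideanSpace.proj 5`).
[folklore] -/
theorem hasFDerivAt_verticalTest (hΨ : Differentiable ℝ Ψ) (p : EuclideanSpace ℝ (Fin 6)) :
    HasFDerivAt (fun z : EuclideanSpace ℝ (Fin 6) => Ψ (z 5))
      ((deriv Ψ (p 5)) • (EuclideanSpace.proj (5 : Fin 6) : EuclideanSpace ℝ (Fin 6) →L[ℝ] ℝ)) p := by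
  have h : HasDerivAt Ψ (deriv Ψ (p 5))
      ((EuclideanSpace.proj (5 : Fin 6) : EuclideanSpace ℝ (Fin 6) →L[ℝ] ℝ) p) :=
    (hΨ _).hasDerivAt
  exact h.comp_hasFDerivAt p
    (EuclideanSpace.proj (5 : Fin 6) : EuclideanSpace ℝ (Fin 6) →L[ℝ] ℝ).hasFDerivAt

/-- `Dφ = (p ↦ Ψ'(p₅) · e₅^*)` for `Ψ` differentiable. [folklore] -/
theorem fderiv_verticalTest (hΨ : Differentiable ℝ Ψ) :
    fderiv ℝ (fun z : EuclideanSpace ℝ (Fin 6) => Ψ (z 5)) = fun p =>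
      (deriv Ψ (p 5)) • (EuclideanSpace.proj (5 : Fin 6) : EuclideanSpace ℝ (Fin 6) →L[ℝ] ℝ) :=
  funext fun p => (hasFDerivAt_verticalTest hΨ p).fderiv

/-- `Dφ_p(a) = Ψ'(p₅) a₅` for `Ψ` differentiable. [folklore] -/
theorem fderiv_verticalTest_apply (hΨ : Differentiable ℝ Ψ) (p a : EuclideanSpace ℝ (Fin 6)) :
    fderiv ℝ (fun z : EuclideanSpace ℝ (Fin 6) => Ψ (z 5)) p a = deriv Ψ (p 5) * a 5 := by
  rw [(hasFDerivAt_verticalTest hΨ p).fderiv, smul_apply, smul_eq_mul]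
  rfl

/-- `D(Dφ)_p = (Ψ''(p₅) · e₅^*) ⊗ e₅^*` for `Ψ ∈ C²`: `Dφ = (Ψ' ∘ e₅^*) · e₅^*` with `Ψ'`
differentiable (`ContDiff.differentiable_deriv_two`), and `deriv (deriv Ψ)` is then the genuine
second derivative. [folklore] -/
theorem hasFDerivAt_fderiv_verticalTest (hΨ : ContDiff ℝ 2 Ψ) (p : EuclideanSpace ℝ (Fin 6)) :
    HasFDerivAt (fderiv ℝ (fun z : EuclideanSpace ℝ (Fin 6) => Ψ (z 5)))
      (((deriv (deriv Ψ) (p 5)) •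
          (EuclideanSpace.proj (5 : Fin 6) : EuclideanSpace ℝ (Fin 6) →L[ℝ] ℝ)).smulRight
        (EuclideanSpace.proj (5 : Fin 6) : EuclideanSpace ℝ (Fin 6) →L[ℝ] ℝ)) p := by
  rw [fderiv_verticalTest (hΨ.differentiable two_ne_zero)]
  exact (hasFDerivAt_verticalTest (Ψ := deriv Ψ) hΨ.differentiable_deriv_two p).smul_const
    (EuclideanSpace.proj (5 : Fin 6) : EuclideanSpace ℝ (Fin 6) →L[ℝ] ℝ)

/-- `D²φ_p(a, b) = Ψ''(p₅) a₅ b₅` for `Ψ ∈ C²`. [folklore] -/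
theorem iteratedFDeriv_two_verticalTest (hΨ : ContDiff ℝ 2 Ψ) (p a b : EuclideanSpace ℝ (Fin 6)) :
    iteratedFDeriv ℝ 2 (fun z : EuclideanSpace ℝ (Fin 6) => Ψ (z 5)) p ![a, b] =
      deriv (deriv Ψ) (p 5) * a 5 * b 5 := by
  rw [iteratedFDeriv_two_apply, (hasFDerivAt_fderiv_verticalTest hΨ p).fderiv,
    Matrix.cons_val_zero, Matrix.cons_val_one, ContinuousLinearMap.smulRight_apply,
    smul_apply, smul_apply, smul_eq_mul, smul_eq_mul]
  rfl

/-- `φ(z) = Ψ(z₅)` is `C²` for `Ψ ∈ C²`. [folklore] -/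
theorem contDiff_verticalTest (hΨ : ContDiff ℝ 2 Ψ) :
    ContDiff ℝ 2 (fun z : EuclideanSpace ℝ (Fin 6) => Ψ (z 5)) :=
  hΨ.comp (EuclideanSpace.proj (5 : Fin 6) : EuclideanSpace ℝ (Fin 6) →L[ℝ] ℝ).contDiff

/-- `Δ_{ℝ⁶} φ = ∑ⱼ D²φ(eⱼ, eⱼ) = Ψ''(z₅)` (only `j = 5` contributes). [folklore] -/
theorem sum_iteratedFDeriv_two_verticalTest_single (hΨ : ContDiff ℝ 2 Ψ)
    (p : EuclideanSpace ℝ (Fin 6)) :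
    ∑ j : Fin 6, iteratedFDeriv ℝ 2 (fun z : EuclideanSpace ℝ (Fin 6) => Ψ (z 5)) p
      ![EuclideanSpace.single j (1 : ℝ), EuclideanSpace.single j (1 : ℝ)] =
      deriv (deriv Ψ) (p 5) := by
  simp only [iteratedFDeriv_two_verticalTest hΨ, PiLp.single_apply]
  simp

end VerticalTest

/-! ## The vertical test identity -/

section Identity

variable {M : Type*} [TopologicalSpace M] [ChartedSpace (EuclideanSpace ℝ (Fin 4)) M]
  [IsManifold (𝓡 4) ∞ M] [CompactSpace M] [T2Space M] [MeasurableSpace M] [BorelSpace M]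

/-- **The vertical test identity** `∫_M (Ψ''(z₅) (1 - ν₅²) - H Ψ'(z₅) ν₅) dμ_g = 0` for a closed
immersed cross-section `f : M⁴ → N = S⁴ × ℝ ⊂ ℝ⁶` with smooth unit normal `ν` tangent to `N`, mean
curvature `H` of `(f, ν)`, `g = f^*δ`, and any `Ψ ∈ C²(ℝ)`: Green's identity
`∫_M Δ_g(φ ∘ f) dμ_g = 0` in ambient terms (`integral_sliceLaplacian_eq_zero`) for `φ(z) = Ψ(z₅)`,
whose integrand is `(Ψ'' - 0 - 0) - (Ψ'' ν₅² - |ν'|² · 0) - H Ψ' ν₅` pointwise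
(`Dφ_p(a) = Ψ'(p₅) a₅`, `D²φ_p(a, b) = Ψ''(p₅) a₅ b₅`, `n₅ = 0`). Equivalently: the first variation
of area along the vertical field `Ψ'(z₅) e₅`. [cite: Hamilton1993, §4] -/
theorem verticalTest_identity {f νf : M → EuclideanSpace ℝ (Fin 6)}
    (hf : (euclideanMetric (EuclideanSpace ℝ (Fin 6))).IsSpacelikeImmersion (𝓡 4) f)
    (hν : ContMDiff (𝓡 4) 𝓘(ℝ, EuclideanSpace ℝ (Fin 6)) ∞ νf)
    (hun : (euclideanMetric (EuclideanSpace ℝ (Fin 6))).IsUnitNormal (𝓡 4) f νf 1)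
    (hN : ∀ x, ∑ i : Fin 5, f x (Fin.castSucc i) ^ 2 = 1)
    (hνN : ∀ x, ∑ i : Fin 5, νf x (Fin.castSucc i) * f x (Fin.castSucc i) = 0)
    {Ψ : ℝ → ℝ} (hΨ : ContDiff ℝ 2 Ψ) :
    ∫ w, (deriv (deriv Ψ) (f w 5) * (1 - νf w 5 ^ 2)
        - (euclideanMetric (EuclideanSpace ℝ (Fin 6))).meanCurvature f contMDiff_pullbackBilin_holds
            hf νf w * (deriv Ψ (f w 5) * νf w 5))
      ∂riemannianMeasure ((euclideanMetric (EuclideanSpace ℝ (Fin 6))).inducedRiemannianMetric f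
        contMDiff_pullbackBilin_holds hf) = 0 := by
  -- Green's identity for `φ = Ψ ∘ e₅^*`
  have h0 := integral_sliceLaplacian_eq_zero hf hν hun hN hνN (contDiff_verticalTest hΨ)
  have hd : Differentiable ℝ Ψ := hΨ.differentiable two_ne_zero
  -- the integrand, pointwise (`H`, `S` stand for the mean curvature and `|ν'|²`)
  have hpt : ∀ (w) (H S : ℝ),
      (((∑ j : Fin 6, iteratedFDeriv ℝ 2 (fun z : EuclideanSpace ℝ (Fin 6) => Ψ (z 5)) (f w)
              ![EuclideanSpace.single j (1 : ℝ), EuclideanSpace.single j (1 : ℝ)])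
            - iteratedFDeriv ℝ 2 (fun z : EuclideanSpace ℝ (Fin 6) => Ψ (z 5)) (f w)
                ![padL (truncL (f w)), padL (truncL (f w))]
            - 4 * fderiv ℝ (fun z : EuclideanSpace ℝ (Fin 6) => Ψ (z 5)) (f w) (padL (truncL (f w))))
          - (iteratedFDeriv ℝ 2 (fun z : EuclideanSpace ℝ (Fin 6) => Ψ (z 5)) (f w) ![νf w, νf w]
            - S * fderiv ℝ (fun z : EuclideanSpace ℝ (Fin 6) => Ψ (z 5)) (f w) (padL (truncL (f w))))
          - H * fderiv ℝ (fun z : EuclideanSpace ℝ (Fin 6) => Ψ (z 5)) (f w) (νf w))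
        = deriv (deriv Ψ) (f w 5) * (1 - νf w 5 ^ 2) - H * (deriv Ψ (f w 5) * νf w 5) := by
    intro w H S
    rw [sum_iteratedFDeriv_two_verticalTest_single hΨ, iteratedFDeriv_two_verticalTest hΨ,
      iteratedFDeriv_two_verticalTest hΨ, fderiv_verticalTest_apply hd,
      fderiv_verticalTest_apply hd, padL_apply_last]
    ring
  exact (integral_congr_ae (Eventually.of_forall fun w => (hpt w _ _).symm)).trans h0

end Identity

/-- **Registered helper `helper_verticalTestIdentity` of line `killing-flux` (a first-variation
identity on closed cross-sections, consumed by the area-quantization step).** For a closed immersed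
cross-section `f : M⁴ → N = S⁴ × ℝ` with smooth unit normal `ν` tangent to `N`, mean curvature `H`
of `(f, ν)` and any `Ψ ∈ C²(ℝ)`: `∫_M (Ψ''(z₅) (1 - ν₅²) - H Ψ'(z₅) ν₅) dμ_g = 0`, `μ_g` the
Riemannian measure of `g = f^*δ` (`verticalTest_identity`). [cite: Hamilton1993, §4] -/
theorem helper_verticalTestIdentity :
    ∀ (M : Type) [TopologicalSpace M] [ChartedSpace (EuclideanSpace ℝ (Fin 4)) M] [IsManifold (𝓡 4) ∞ M] [CompactSpace M] [T2Space M] [MeasurableSpace M] [BorelSpace M] (f νf : M → EuclideanSpace ℝ (Fin 6)) (hf : (Literature.Geometry.Riemannian.euclideanMetric (EuclideanSpace ℝ (Fin 6))).IsSpacelikeImmersion (𝓡 4) f), ContMDiff (𝓡 4) (𝓡 6) ∞ νf → (Literature.Geometry.Riemannian.euclideanMetric (EuclideanSpace ℝ (Fin 6))).IsUnitNormal (𝓡 4) f νf 1 → (∀ x, ∑ i : Fin 5, f x (Fin.castSucc i) ^ 2 = 1) → (∀ x, ∑ i : Fin 5, νf x (Fin.castSucc i) * f x (Fin.castSucc i)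 = 0) → ∀ (Ψ : ℝ → ℝ), ContDiff ℝ 2 Ψ → ∫ w, (deriv (deriv Ψ) (f w 5) * (1 - νf w 5 ^ 2) - (Literature.Geometry.Riemannian.euclideanMetric (EuclideanSpace ℝ (Fin 6))).meanCurvature f Literature.Geometry.Lorentzian.PseudoRiemannianMetric.contMDiff_pullbackBilin_holds hf νf w * (deriv Ψ (f w 5) * νf w 5)) ∂Literature.Geometry.Lorentzian.riemannianMeasure ((Literature.Geometry.Riemannian.euclideanMetric (EuclideanSpace ℝ (Fin 6))).inducedRiemannianMetric f Literature.Geometry.Lorentzian.PseudoRiemannianMetric.contMDiff_pullbackBilin_holds hf) = 0 :=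
  fun _ _ _ _ _ _ _ _ _ _ hf hν hun hN hνN _ hΨ =>
    verticalTest_identity hf hν hun hN hνN hΨ

end Summit.SmoothPoincare4.SmoothPoincare4.Cruxes.CylinderRungTwo.KillingFlux

end
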